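import Summits.Ventures.YMGap.Conjectures.StrongCouplingChiralLROReflectionPositivity
import Literature.MathematicalPhysics.QuantumLattice.StaggeredSchwingerDysonFixedGauge
import Literature.MathematicalPhysics.QuantumLattice.GaugeLinkResampling
import Literature.MathematicalPhysics.QuantumLattice.StaggeredCouplingContinuity
import HarnessLib
import HarnessLib.Audit.Tags

/-!
# Row S4 of Y3 at `β ≥ 0` (1/3): the un-normalised functionals `J_β`, `S_β` of the massless `U(N)` theory

Cell `pub-ymgap`, seat qcd-lit g19 (literature-prover), `bears_on: Q1` (typed node
`SalmhoferSeilerSmallBeta`, census row S4: the Schwinger–Dyson lower bound at small `β > 0`, uniformly in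
the volume).  Everything is a theorem (0 facts).  This first file fixes the objects of the argument and
their bookkeeping; the estimates are in `…SchwingerDysonOneLink` and `…SchwingerDysonEstimates`.

* `J_β(G) = ∫ e^{-βS_W(U)} ∫dψ̄dψ G e^{A(U)} ∏dU` (`sdJ`; `A(U)` the massless staggered action, periodic b.c.)
  and `S_β(G) = ∫ e^{-βS_W} · s∫dψ̄dψ G e^{A(U)} ∏dU` (`sdS`) with the chiral sign `s = ±1` of the tree's
  `StaggeredChiralSwapPositivity`: `s ∫dψ̄dψ G e^{A(U)} ≥ 0` for EVERY gauge field and every `G` in the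
  chiral cone, so `S_β(G) ≥ 0` (`sdS_nonneg`) — this replaces Salmhofer–Seiler's termwise positivity at
  `β = 0` [SalmhoferSeiler1991, (3.59), (4.33)–(4.34)].
* `S_β(1) > 0` at every real `β` (`sdS_one_pos`, from the tree's `Z_Λ(β,0) > 0`), and the conjecture's
  two-point function is `ssTwoPoint N ν L β 0 x y = (2N)² S_β(σ_xσ_y)/S_β(1)` (`ssTwoPoint_eq_spinPair`).
* Regularity (continuity in the gauge field, integrability on `∏dU` and on `∏dU × dg`) and the resampled
  forms `J_β(G) = ∫∫ e^{-βS_W(U[e←g])} ∫dψ̄dψ G e^{A(U[e←g])} dg ∏dU` (`sdJ_eq_integral_prod`, from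
  `GaugeLinkResampling`).

[cite: SalmhoferSeiler1991, §2 (2.9)–(2.14), (3.59)]; positivity device [cite: MontvayMunster1994, §5.1.6 (5.120)–(5.121)].
-/

noncomputable section

open MeasureTheory Finset
open scoped ComplexConjugate Matrix BigOperators
open Literature.MathematicalPhysics.QuantumFieldTheory (Site Edge GaugeConfig wilsonAction wilsonWeight wilsonMeasure
  partitionFunction haarProbability)
open Literature.MathematicalPhysics.QuantumLattice
open Literature.MathematicalPhysics.QuantumLattice.GrassmannAlgebra
open Literature.MathematicalPhysics.QuantumLattice.StrongCoupling
open Literature.MathematicalPhysics.QuantumLattice.StaggeredRP (expect definingRep eoParity_torusLinks)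
open Literature.MathematicalPhysics.QuantumLattice.StaggeredDeterminant (eoParity)
open Literature.MathematicalPhysics.StatisticalMechanics (ComplexSpin.HasLog ComplexSpin.uNBondCoeff)
open Literature.Probability.LatticeModels (TorusSite)

namespace Summit.Ventures.YMGap.Conjectures

namespace SchwingerDyson

variable {N ν L : ℕ} [NeZero L]

/-! ### The objects -/

variable (ν L) in
/-- The even sublattice `{x : ∑_μ x_μ ≡ 0 (2)}` (the block `E` of the chiral swap). [cite: SalmhoferSeiler1991, §2 (2.8)] -/
def evens : Finset (TorusSite ν L) := Finset.univ.filter fun x => eoParity x = 0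

variable (N ν L) in
/-- The plaquette Boltzmann factor `e^{-β S_W(U)}` of the `U(N)` Wilson action. [cite: SalmhoferSeiler1991, §2 (2.2)] -/
def plaq (β : ℝ) (U : GaugeConfig ν L (UN N)) : ℝ :=
  Real.exp (-β * wilsonAction (unitaryFundamentalRep (Fin N) ℂ) U)

variable (N ν L) in
/-- The product Haar measure `∏_e dU_e`. [cite: SalmhoferSeiler1991, §2 (2.12)] -/
abbrev haarPi : Measure (GaugeConfig ν L (UN N)) := Measure.pi fun _ : Edge ν L => haarProbability (UN N)

variable [LinearOrder (TorusSite ν L)]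

/-- The massless fermionic Boltzmann element `e^{A(U)}`, `A(U) = -S_F(U)|_{m=0}` (periodic). [cite: SalmhoferSeiler1991, §2 (2.3)] -/
abbrev fermiW (U : GaugeConfig ν L (UN N)) : FermiAlg (TorusSite ν L) N :=
  grassmannExp (actionOn Finset.univ (torusLinks ν L) (stagSigns ν L) U)

variable (N ν L) in
/-- **`J_β(G) = ∫ e^{-βS_W(U)} ∫dψ̄dψ G e^{A(U)} ∏ dU`** (un-normalised, periodic staggered fermions). [cite: SalmhoferSeiler1991, §2 (2.9)–(2.10)] -/
def sdJ (β : ℝ) (G : FermiAlg (TorusSite ν L) N) : ℂ :=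
  ∫ U, (plaq N ν L β U : ℂ) * berezin ℂ _ (G * fermiW U) ∂(haarPi N ν L)

variable (N ν L) in
/-- **`S_β(G) = ∫ e^{-βS_W(U)} · s ∫dψ̄dψ G e^{A(U)} ∏ dU`** with the chiral sign `s` — nonnegative on the
chiral cone. [cite: MontvayMunster1994, §5.1.6 (5.120)–(5.121)] -/
def sdS (β : ℝ) (G : FermiAlg (TorusSite ν L) N) : ℝ :=
  ∫ U, plaq N ν L β U * (chiralSign (N := N) (evens ν L) * berezin ℂ _ (G * fermiW U)).re ∂(haarPi N ν L)

/-! ### Elementary facts about the torus data -/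

omit [LinearOrder (TorusSite ν L)] in
/-- On the even torus every link joins the even and the odd sublattice. [cite: SalmhoferSeiler1991, §2 (2.8)] -/
theorem fst_mem_evens_iff (hL : Even L) (b : Edge ν L) :
    (torusLinks ν L b).1 ∈ evens ν L ↔ (torusLinks ν L b).2 ∉ evens ν L := by
  simp only [evens, Finset.mem_filter, Finset.mem_univ, true_and, eoParity_torusLinks hL b]
  have key : ∀ p : ZMod 2, p = 0 ↔ ¬ (p + 1 = 0) := by decide
  exact key _

omit [LinearOrder (TorusSite ν L)] in
/-- The staggered signs are real. [cite: SalmhoferSeiler1991, §2 (2.3)] -/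
theorem conj_stagSigns (b : Edge ν L) : conj (stagSigns ν L b) = stagSigns ν L b := by
  simp [stagSigns]

omit [LinearOrder (TorusSite ν L)] in
/-- `Γ_b² = 1`. [cite: SalmhoferSeiler1991, §2 (2.3)] -/
theorem stagSigns_sq (b : Edge ν L) : stagSigns ν L b ^ 2 = 1 := staggeredPhase_sq b.1 b.2

omit [LinearOrder (TorusSite ν L)] in
/-- `‖Γ_b‖ = 1`. [cite: SalmhoferSeiler1991, §2 (2.3)] -/
theorem norm_stagSigns (b : Edge ν L) : ‖stagSigns ν L b‖ = 1 := by
  have h := congrArg (fun z : ℂ => ‖z‖) (stagSigns_sq (ν := ν) (L := L) b)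
  simp only [norm_pow, norm_one] at h
  nlinarith [norm_nonneg (stagSigns ν L b)]

omit [LinearOrder (TorusSite ν L)] in
/-- `0 < e^{-βS_W}`. [cite: SalmhoferSeiler1991, §2 (2.2)] -/
theorem plaq_pos (β : ℝ) (U : GaugeConfig ν L (UN N)) : 0 < plaq N ν L β U := Real.exp_pos _

/-! ### Pointwise positivity (every gauge field) -/

/-- **`s ∫dψ̄dψ G e^{A(U)} ≥ 0` and real, for EVERY gauge field**, `G` in the chiral cone. [cite: MontvayMunster1994, §5.1.6 (5.120)–(5.121)] -/
theorem chiralSign_mul_berezin_fermiW (hL : Even L) {G : FermiAlg (TorusSite ν L) N} (hG : IsChiralPositive (evens ν L) G)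
    (U : GaugeConfig ν L (UN N)) :
    0 ≤ (chiralSign (N := N) (evens ν L) * berezin ℂ _ (G * fermiW U)).re ∧
      (chiralSign (N := N) (evens ν L) * berezin ℂ _ (G * fermiW U)).im = 0 :=
  chiralSign_mul_berezin_actionOn_nonneg _ _ (fst_mem_evens_iff hL) conj_stagSigns U hG

/-- The same as an identity in `ℂ`: `s ∫dψ̄dψ G e^{A(U)} = (its real part : ℂ)`. [cite: MontvayMunster1994, §5.1.6 (5.120)–(5.121)] -/
theorem chiralSign_mul_berezin_fermiW_eq_re (hL : Even L) {G : FermiAlg (TorusSite ν L) N}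
    (hG : IsChiralPositive (evens ν L) G) (U : GaugeConfig ν L (UN N)) :
    chiralSign (N := N) (evens ν L) * berezin ℂ _ (G * fermiW U) =
      ((chiralSign (N := N) (evens ν L) * berezin ℂ _ (G * fermiW U)).re : ℂ) :=
  Complex.ext (by simp) (by simp [(chiralSign_mul_berezin_fermiW hL hG U).2])

/-- `‖∫dψ̄dψ G e^{A(U)}‖ = s ∫dψ̄dψ G e^{A(U)}` on the cone. [cite: MontvayMunster1994, §5.1.6 (5.120)–(5.121)] -/
theorem norm_berezin_fermiW (hL : Even L) {G : FermiAlg (TorusSite ν L) N} (hG : IsChiralPositive (evens ν L) G)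
    (U : GaugeConfig ν L (UN N)) :
    ‖berezin ℂ _ (G * fermiW U)‖ = (chiralSign (N := N) (evens ν L) * berezin ℂ _ (G * fermiW U)).re := by
  have h1 : ‖chiralSign (N := N) (evens ν L) * berezin ℂ _ (G * fermiW U)‖ = ‖berezin ℂ _ (G * fermiW U)‖ := by
    rw [norm_mul, norm_chiralSign, one_mul]
  calc ‖berezin ℂ _ (G * fermiW U)‖ = ‖chiralSign (N := N) (evens ν L) * berezin ℂ _ (G * fermiW U)‖ := h1.symm
    _ = ‖((chiralSign (N := N) (evens ν L) * berezin ℂ _ (G * fermiW U)).re : ℂ)‖ := by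
        rw [← chiralSign_mul_berezin_fermiW_eq_re hL hG U]
    _ = _ := by rw [Complex.norm_real, Real.norm_eq_abs, abs_of_nonneg (chiralSign_mul_berezin_fermiW hL hG U).1]

/-- `S_β(G) ≥ 0` on the chiral cone, every real `β`. [cite: MontvayMunster1994, §5.1.6 (5.120)–(5.121)] -/
theorem sdS_nonneg (hL : Even L) (β : ℝ) {G : FermiAlg (TorusSite ν L) N} (hG : IsChiralPositive (evens ν L) G) :
    0 ≤ sdS N ν L β G :=
  integral_nonneg fun U => mul_nonneg (plaq_pos β U).le (chiralSign_mul_berezin_fermiW hL hG U).1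

/-! ### Regularity: continuity of the integrands, integrability on `∏dU` and on `∏dU × dg` -/

omit [NeZero L] [LinearOrder (TorusSite ν L)] in
/-- `U(N)` is second countable (Borel structure of products). [cite: SalmhoferSeiler1991, §2 (2.12)] -/
theorem secondCountable_UN : SecondCountableTopology (UN N) := by
  haveI : SecondCountableTopology (Matrix (Fin N) (Fin N) ℂ) := inferInstanceAs (SecondCountableTopology (Fin N → Fin N → ℂ))
  exact TopologicalSpace.Subtype.secondCountableTopology _

omit [NeZero L] [LinearOrder (TorusSite ν L)] in
/-- A linear functional of a coefficientwise continuous family is continuous. [cite: SalmhoferSeiler1991, §2 (2.12)] -/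
theorem continuous_apply_of_coeffContinuous {Ω κ : Type*} [TopologicalSpace Ω] [LinearOrder κ] [Fintype κ]
    {F : Ω → GrassmannAlgebra ℂ κ} (hF : CoeffContinuous F) (φ : GrassmannAlgebra ℂ κ →ₗ[ℂ] ℂ) :
    Continuous fun ω => φ (F ω) := by
  have h : (fun ω => φ (F ω)) = fun ω => ∑ t : Finset κ, coord t (F ω) * φ (grassmannBasis ℂ κ t) := by
    funext ω
    conv_lhs => rw [eq_sum_coord_smul (F ω)]
    simp only [map_sum, map_smul, smul_eq_mul]
  rw [h]
  exact continuous_finsetSum _ fun t _ => (hF t).mul continuous_const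

/-- The hopping term depends continuously (coefficientwise) on the matrix. [cite: SalmhoferSeiler1991, §2 (2.12)] -/
theorem coeffContinuous_hopAt {Ω : Type*} [TopologicalSpace Ω] (x y : TorusSite ν L) {f : Ω → Matrix (Fin N) (Fin N) ℂ}
    (hf : Continuous f) : CoeffContinuous fun ω => (hopAt x y (f ω) : FermiAlg (TorusSite ν L) N) := by
  unfold hopAt
  refine CoeffContinuous.sum _ fun a _ => CoeffContinuous.sum _ fun c _ => ?_
  exact (CoeffContinuous.const _).smul ((continuous_apply c).comp ((continuous_apply a).comp hf))

/-- The bond term `A_b(U_b)` depends continuously on the gauge field. [cite: SalmhoferSeiler1991, §2 (2.12)] -/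
theorem coeffContinuous_bondTerm (b : Edge ν L) :
    CoeffContinuous fun U : GaugeConfig ν L (UN N) => bondTerm (torusLinks ν L) (stagSigns ν L) U b := by
  have hU : Continuous fun U : GaugeConfig ν L (UN N) => ((U b : UN N) : Matrix (Fin N) (Fin N) ℂ) :=
    continuous_subtype_val.comp (continuous_apply b)
  unfold bondTerm
  exact ((coeffContinuous_hopAt _ _ hU).smul continuous_const).add
    ((coeffContinuous_hopAt _ _ hU.matrix_conjTranspose).smul continuous_const)

/-- The kinetic insertion depends continuously on the gauge field. [cite: SalmhoferSeiler1991, §2 (2.12)] -/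
theorem coeffContinuous_kinAt (x : TorusSite ν L) (b : Edge ν L) :
    CoeffContinuous fun U : GaugeConfig ν L (UN N) => kinAt x (torusLinks ν L) (stagSigns ν L) U b :=
  (coeffContinuous_bondTerm b).linearMap (chargeOp ℂ (barCharge (N := N) x))

/-- `e^{A(U)}` depends continuously on the gauge field. [cite: SalmhoferSeiler1991, §2 (2.12)] -/
theorem coeffContinuous_fermiW (hL : Even L) : CoeffContinuous fun U : GaugeConfig ν L (UN N) => fermiW (N := N) U := by
  have hfun : (fun U : GaugeConfig ν L (UN N) => fermiW (N := N) U) = fermiBoltzmann (torusLinks ν L) (stagSigns ν L) 0 :=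
    funext fun U => (fermiBoltzmann_zero_eq_grassmannExp_actionOn _ _ U).symm
  rw [hfun]
  exact coeffContinuous_fermiBoltzmann _ (torusLinks_ne (StaggeredRP.one_lt_of_even_neZero hL)) _ _

omit [LinearOrder (TorusSite ν L)] in
/-- The plaquette factor is continuous. [cite: SalmhoferSeiler1991, §2 (2.2)] -/
theorem continuous_plaq (β : ℝ) : Continuous (plaq N ν L β) := continuous_exp_wilsonAction β

omit [LinearOrder (TorusSite ν L)] in
/-- Continuous functions of the gauge field are `∏dU`-integrable. [cite: SalmhoferSeiler1991, §2 (2.12)] -/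
theorem integrable_of_continuous {E : Type*} [NormedAddCommGroup E] {f : GaugeConfig ν L (UN N) → E} (hf : Continuous f) :
    Integrable f (haarPi N ν L) := by
  haveI := secondCountable_UN (N := N)
  exact hf.integrable_of_hasCompactSupport (HasCompactSupport.of_compactSpace f)

omit [LinearOrder (TorusSite ν L)] in
/-- Continuous functions of (gauge field, one extra link variable) are `∏dU × dg`-integrable. [cite: SalmhoferSeiler1991, §2 (2.12)] -/
theorem integrable_of_continuous_prod {E : Type*} [NormedAddCommGroup E] {f : GaugeConfig ν L (UN N) × UN N → E}
    (hf : Continuous f) : Integrable f ((haarPi N ν L).prod (haarProbability (UN N))) := by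
  haveI := secondCountable_UN (N := N)
  exact hf.integrable_of_hasCompactSupport (HasCompactSupport.of_compactSpace f)

omit [NeZero L] [LinearOrder (TorusSite ν L)] in
/-- Continuous functions of one link variable are Haar-integrable. [cite: SalmhoferSeiler1991, §2 (2.12)] -/
theorem integrable_of_continuous_haar {E : Type*} [NormedAddCommGroup E] {f : UN N → E} (hf : Continuous f) :
    Integrable f (haarProbability (UN N)) := by
  haveI := secondCountable_UN (N := N)
  exact hf.integrable_of_hasCompactSupport (HasCompactSupport.of_compactSpace f)

omit [NeZero L] [LinearOrder (TorusSite ν L)] in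
/-- Resampling a link is continuous. [cite: SalmhoferSeiler1991, §2 (2.12)] -/
theorem continuous_upd (e : Edge ν L) : Continuous fun p : GaugeConfig ν L (UN N) × UN N => Function.update p.1 e p.2 :=
  continuous_update e

/-! ### `S_β` versus `J_β`, and the resampled (product-space) forms -/

/-- `s · J_β(G) = S_β(G)` for `G` in the chiral cone. [cite: MontvayMunster1994, §5.1.6 (5.120)–(5.121)] -/
theorem chiralSign_mul_sdJ (hL : Even L) (β : ℝ) {G : FermiAlg (TorusSite ν L) N} (hG : IsChiralPositive (evens ν L) G) :
    chiralSign (N := N) (evens ν L) * sdJ N ν L β G = (sdS N ν L β G : ℂ) := by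
  rw [sdJ, sdS, ← integral_const_mul, ← integral_complex_ofReal]
  refine integral_congr_ae (ae_of_all _ fun U => ?_)
  dsimp only
  rw [mul_left_comm, chiralSign_mul_berezin_fermiW_eq_re hL hG U, Complex.ofReal_re]
  push_cast
  ring

/-- `Re(s · J_β(G)) = S_β(G)` for every `G`. [cite: SalmhoferSeiler1991, §2 (2.9)–(2.10)] -/
theorem re_chiralSign_mul_sdJ (hL : Even L) (β : ℝ) (G : FermiAlg (TorusSite ν L) N) :
    (chiralSign (N := N) (evens ν L) * sdJ N ν L β G).re = sdS N ν L β G := by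
  have hint : Integrable (fun U => (plaq N ν L β U : ℂ) * (chiralSign (N := N) (evens ν L) * berezin ℂ _ (G * fermiW U)))
      (haarPi N ν L) :=
    integrable_of_continuous ((Complex.continuous_ofReal.comp (continuous_plaq β)).mul
      (continuous_const.mul (continuous_apply_of_coeffContinuous ((CoeffContinuous.const G).mul (coeffContinuous_fermiW hL)) _)))
  rw [sdJ, sdS, ← integral_const_mul]
  simp_rw [mul_left_comm (chiralSign (N := N) (evens ν L))]
  rw [← RCLike.re_eq_complex_re, ← integral_re hint]
  refine integral_congr_ae (ae_of_all _ fun U => ?_)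
  dsimp only
  rw [RCLike.re_eq_complex_re, Complex.re_ofReal_mul]

/-- **`J_β(G)` in resampled form**: `J_β(G) = ∫∫ e^{-βS_W(U[e←g])} ∫dψ̄dψ G e^{A(U[e←g])} dg ∏dU`. [cite: SalmhoferSeiler1991, §2 (2.12) and p. 400] -/
theorem sdJ_eq_integral_prod (hL : Even L) (β : ℝ) (e : Edge ν L) (G : FermiAlg (TorusSite ν L) N) :
    sdJ N ν L β G = ∫ p, (plaq N ν L β (Function.update p.1 e p.2) : ℂ) *
      berezin ℂ _ (G * fermiW (Function.update p.1 e p.2)) ∂((haarPi N ν L).prod (haarProbability (UN N))) := by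
  rw [sdJ, ← integral_update_prod_eq (haarProbability (UN N)) e]
  exact integrable_of_continuous ((Complex.continuous_ofReal.comp (continuous_plaq β)).mul
    (continuous_apply_of_coeffContinuous ((CoeffContinuous.const G).mul (coeffContinuous_fermiW hL)) _))

/-- **`S_β(G)` in resampled form.** [cite: SalmhoferSeiler1991, §2 (2.12) and p. 400] -/
theorem sdS_eq_integral_prod (hL : Even L) (β : ℝ) (e : Edge ν L) (G : FermiAlg (TorusSite ν L) N) :
    sdS N ν L β G = ∫ p, plaq N ν L β (Function.update p.1 e p.2) *
      (chiralSign (N := N) (evens ν L) * berezin ℂ _ (G * fermiW (Function.update p.1 e p.2))).re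
        ∂((haarPi N ν L).prod (haarProbability (UN N))) := by
  rw [sdS, ← integral_update_prod_eq (haarProbability (UN N)) e]
  exact integrable_of_continuous ((continuous_plaq β).mul (Complex.continuous_re.comp
    (continuous_const.mul (continuous_apply_of_coeffContinuous ((CoeffContinuous.const G).mul (coeffContinuous_fermiW hL)) _))))

/-- The insertion integral `I_b(F)` in resampled form. [cite: SalmhoferSeiler1991, §2 (2.12) and p. 400] -/
theorem kinJ_eq_integral_prod (hL : Even L) (β : ℝ) (x : TorusSite ν L) (e : Edge ν L) (F : FermiAlg (TorusSite ν L) N) :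
    ∫ U, (plaq N ν L β U : ℂ) * berezin ℂ _ (F * kinAt x (torusLinks ν L) (stagSigns ν L) U e * fermiW U) ∂(haarPi N ν L) =
      ∫ p, (plaq N ν L β (Function.update p.1 e p.2) : ℂ) *
        berezin ℂ _ (F * kinAt x (torusLinks ν L) (stagSigns ν L) (Function.update p.1 e p.2) e *
          fermiW (Function.update p.1 e p.2)) ∂((haarPi N ν L).prod (haarProbability (UN N))) := by
  rw [← integral_update_prod_eq (haarProbability (UN N)) e]
  exact integrable_of_continuous ((Complex.continuous_ofReal.comp (continuous_plaq β)).mul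
    (continuous_apply_of_coeffContinuous (((CoeffContinuous.const F).mul (coeffContinuous_kinAt x e)).mul
      (coeffContinuous_fermiW hL)) _))

/-! ### `S_β(1) > 0` and the bridge to the conjecture's two-point function -/

/-- **`S_β(1) > 0` at every real `β`** (even `L`, `ν ≥ 1`): `S_β(1) = ∫ e^{-βS_W} |det D₀[U]| ≥ ∫ e^{-βS_W} Re det D₀[U] > 0`. [cite: SalmhoferSeiler1991, §2 (2.9)–(2.12)] -/
theorem sdS_one_pos [NeZero ν] (hL : Even L) (β : ℝ) : 0 < sdS N ν L β 1 := by
  have hpos := integral_det_D0_re_wilsonWeight_pos (ν := ν) (L := L) (N := N) hL β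
  rw [StaggeredRP.integral_wilsonWeight_eq_integral_exp_smul _ continuous_subtype_val] at hpos
  refine lt_of_lt_of_le hpos (integral_mono_of_nonneg (ae_of_all _ fun U => ?_) ?_ (ae_of_all _ fun U => ?_))
  · exact smul_nonneg (Real.exp_pos _).le (det_D0_re_nonneg hL.two_dvd U)
  · exact integrable_of_continuous ((continuous_plaq β).mul (Complex.continuous_re.comp
      (continuous_const.mul (continuous_apply_of_coeffContinuous ((CoeffContinuous.const _).mul (coeffContinuous_fermiW hL)) _))))
  · show Real.exp (-β * wilsonAction (unitaryFundamentalRep (Fin N) ℂ) U) • ((StaggeredSingular.D0 U).det).re ≤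
      plaq N ν L β U * (chiralSign (N := N) (evens ν L) * berezin ℂ _ (1 * fermiW U)).re
    rw [smul_eq_mul, plaq]
    refine mul_le_mul_of_nonneg_left ?_ (Real.exp_pos _).le
    rw [← norm_berezin_fermiW hL IsChiralPositive.one U, one_mul,
      show fermiW (N := N) U = fermiBoltzmann (torusLinks ν L) (stagSigns ν L) ((0 : ℝ) : ℂ) U by
        rw [Complex.ofReal_zero]; exact (fermiBoltzmann_zero_eq_grassmannExp_actionOn _ _ U).symm,
      berezin_fermiBoltzmann_torus U, norm_mul, StaggeredRP.norm_orientationSign, one_mul, det_neg_D0 hL]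
    exact Complex.re_le_norm _

/-- **The conjecture's massless two-point function in terms of `S_β`**:
`ssTwoPoint N ν L β 0 x y = S_β(ψ̄ψ(x)ψ̄ψ(y)) / S_β(1)` (even `L`, `ν ≥ 1`, every real `β`). [cite: SalmhoferSeiler1991, §2 (2.9)–(2.10), (2.14)] -/
theorem ssTwoPoint_eq_sdS_div [NeZero ν] (hL : Even L) (β : ℝ) (x y : TorusSite ν L) :
    ssTwoPoint N ν L β 0 x y = sdS N ν L β (meson x * meson y) / sdS N ν L β 1 := by
  rw [ssTwoPoint_massless_eq_expect_re N ν L hL β x y, StaggeredRP.expect_definingRep_eq_periodic β 0 fun _ => rfl]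
  -- the normalisation `Z_g(β)⁻¹` of the Wilson measure cancels
  have hc0 : (((partitionFunction (d := ν) (L := L) (unitaryFundamentalRep (Fin N) ℂ) β)⁻¹).toReal : ℂ) ≠ 0 :=
    Complex.ofReal_ne_zero.2 (StaggeredRP.partitionFunction_inv_toReal_pos (d := ν) (N := N) β).ne'
  have hfB : ∀ U : GaugeConfig ν L (UN N), fermiBoltzmann (torusLinks ν L) (stagSigns ν L) ((0 : ℝ) : ℂ) U = fermiW U := by
    intro U; rw [Complex.ofReal_zero]; exact fermiBoltzmann_zero_eq_grassmannExp_actionOn _ _ U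
  have hnum : ∫ U, berezin ℂ _ ((meson x * meson y : FermiAlg (TorusSite ν L) N) *
        fermiBoltzmann (torusLinks ν L) (stagSigns ν L) ((0 : ℝ) : ℂ) U)
        ∂(wilsonMeasure (d := ν) (L := L) (unitaryFundamentalRep (Fin N) ℂ) β) =
      (((partitionFunction (d := ν) (L := L) (unitaryFundamentalRep (Fin N) ℂ) β)⁻¹).toReal : ℂ) * sdJ N ν L β (meson x * meson y) := by
    rw [wilsonMeasure, integral_smul_measure, StaggeredRP.integral_wilsonWeight_eq_integral_exp_smul _ continuous_subtype_val, sdJ,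
      Complex.real_smul]
    congr 1
    exact integral_congr_ae (ae_of_all _ fun U => by dsimp only; rw [Complex.real_smul, hfB]; rfl)
  have hden : ∫ U, berezin ℂ _ (fermiBoltzmann (torusLinks ν L) (stagSigns ν L) ((0 : ℝ) : ℂ) U)
        ∂(wilsonMeasure (d := ν) (L := L) (unitaryFundamentalRep (Fin N) ℂ) β) =
      (((partitionFunction (d := ν) (L := L) (unitaryFundamentalRep (Fin N) ℂ) β)⁻¹).toReal : ℂ) * sdJ N ν L β 1 := by
    rw [wilsonMeasure, integral_smul_measure, StaggeredRP.integral_wilsonWeight_eq_integral_exp_smul _ continuous_subtype_val, sdJ,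
      Complex.real_smul]
    congr 1
    exact integral_congr_ae (ae_of_all _ fun U => by dsimp only; rw [Complex.real_smul, hfB, one_mul]; rfl)
  rw [hnum, hden, mul_div_mul_left _ _ hc0]
  -- multiply numerator and denominator by the chiral sign
  have hs : chiralSign (N := N) (evens ν L) ≠ 0 := by
    intro h; have := chiralSign_mul_self (N := N) (evens ν L); rw [h, mul_zero] at this; exact zero_ne_one this
  rw [← mul_div_mul_left _ _ hs, chiralSign_mul_sdJ hL β ((isChiralPositive_meson _ x).mul (isChiralPositive_meson _ y)),
    chiralSign_mul_sdJ hL β IsChiralPositive.one, ← Complex.ofReal_div, Complex.ofReal_re]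

omit [NeZero L] in
/-- `ψ̄ψ(x)ψ̄ψ(y) = (2N)² σ_xσ_y`. [cite: SalmhoferSeiler1991, §2 (2.20)–(2.21)] -/
theorem meson_mul_meson_eq_smul_spinPair (hN : N ≠ 0) (x y : TorusSite ν L) :
    (meson x * meson y : FermiAlg (TorusSite ν L) N) = (((2 * N : ℝ) ^ 2 : ℝ) : ℂ) • spinPair x y := by
  rw [spinPair, smul_smul]
  have hN' : (N : ℂ) ≠ 0 := Nat.cast_ne_zero.mpr hN
  rw [show ((((2 * N : ℝ) ^ 2 : ℝ) : ℂ) * (1 / (4 * (N : ℂ) ^ 2))) = 1 by push_cast; field_simp; ring, one_smul]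

/-- `S_β` is real-linear: `S_β(r G) = r S_β(G)`. [cite: SalmhoferSeiler1991, §2 (2.10)] -/
theorem sdS_smul (β r : ℝ) (G : FermiAlg (TorusSite ν L) N) : sdS N ν L β ((r : ℂ) • G) = r * sdS N ν L β G := by
  rw [sdS, sdS, ← integral_const_mul]
  refine integral_congr_ae (ae_of_all _ fun U => ?_)
  dsimp only
  rw [smul_mul_assoc, map_smul, smul_eq_mul, mul_left_comm, Complex.re_ofReal_mul]
  ring

/-- **`ssTwoPoint N ν L β 0 x y = (2N)² S_β(σ_xσ_y)/S_β(1)`.** [cite: SalmhoferSeiler1991, §2 (2.14), (2.20)–(2.21)] -/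
theorem ssTwoPoint_eq_spinPair [NeZero ν] (hN : N ≠ 0) (hL : Even L) (β : ℝ) (x y : TorusSite ν L) :
    ssTwoPoint N ν L β 0 x y = (2 * N : ℝ) ^ 2 * sdS N ν L β (spinPair x y) / sdS N ν L β 1 := by
  rw [ssTwoPoint_eq_sdS_div hL, meson_mul_meson_eq_smul_spinPair hN, sdS_smul]

end SchwingerDyson

end Summit.Ventures.YMGap.Conjectures
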